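import Literature.Probability.LatticeModels.RandomClusterProofs
import Literature.Probability.LatticeModels.RandomClusterRegionCrossingBound
import Literature.Probability.LatticeModels.IsingDisorderFermion
import Mathlib.Analysis.SpecialFunctions.Log.Basic
import Mathlib.Analysis.Convex.SpecificFunctions.Basic
import HarnessLib

/-!
# The FK representation of Ising disorder operators and Aizenman's deconfinement mechanism

Topic `Literature/Probability/LatticeModels` (graphical ∕ FK-type representations; the `ℤ₂`
lattice-gauge application is by duality, see the census row A5 of cell `ym-ir`). Everything is
proved; there is no named fact.

For the free-boundary, zero-field Ising model with unit couplings on a finite graph `G = (V, E)`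
and a set `S ⊆ E` of bonds, the **disorder operator** `T_S` reverses the sign of the couplings on
`S`; its "expectation" is the ratio of partition functions
`⟨T_S⟩_{G,β} = Z_{G,β}(T_S J) / Z_{G,β}(J) = ⟨μ_S⟩_{G,β}`, `μ_S = exp(-2β ∑_{e ∈ S} σ_e)` being the
tree's disorder insertion `disorderWeight β S` (`IsingDisorderFermion.lean`; Kadanoff–Ceva 1971).
In three dimensions, for `S` the plaquettes dual to a surface spanning a loop `γ`, `⟨T_S⟩` of the
dual Ising model IS the `ℤ₂` lattice-gauge Wilson loop expectation `⟨∏_{b ∈ γ} A_b⟩`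
(Wegner 1971; Aizenman 2025, Thm 9.2 — the torus form of this duality is the tree's
`IsingGaugeWegnerDuality.lean`).

* §1 **Frustration** (Aizenman 2025, Def. 7.1): `IsUnfrustrated S ω` — the open edges of `ω`
  admit a spin assignment which is parallel across the open edges off `S` and antiparallel across
  the open edges in `S`; `unfrustrated_eq_loopEven`: this holds iff every closed walk along open
  edges uses an even number of edges of `S` (the printed definition; Harary's balance criterion for
  signed graphs), `loopEven S`.
* §2 **The FK representation of the disorder operator** (Aizenman 2025, Thm 7.2 for the coupling
  pattern `T_S J`, `J ≡ 1`, and Thm 8.1, second line):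
  `isingExpect_disorderWeight_eq_rcMeasure_unfrustrated`:
  `⟨μ_S⟩^{free}_{G,β} = φ_{G, 1 - e^{-2β}, 2}(ω is S-unfrustrated)`, `β ≥ 0`. Proof = the
  Edwards–Sokal computation of `RandomClusterProofs.lean` with the sign-reversed constraint on `S`:
  `∑_σ 1{σ_e = ε_S(e) ∀ e ∈ ω} = 2^{k(ω)} · 1[ω unfrustrated]` (`sum_boole_bondSpin_eq_edgeSign`).
* §3 **The cylinder criterion** (Aizenman 2025, §9.3, the step "(∂Γ)₁ ↮ (∂Γ)₂ ⇒ parity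
  condition"), abstractly: if `S` is *transversal* to a vertex set `Γ` two-coloured by `h`
  (`IsTransversal`: the `S`-bonds join the two colour classes inside `Γ`, and every bond of `G` inside
  `Γ` joining the two classes is in `S`), then a configuration in which no open path joins the two
  *walls* of `Γ` (vertices of `Γ` of the given colour with a neighbour outside `Γ`) is
  `S`-unfrustrated (`isUnfrustrated_of_wallsDisconnected`).
* §4 **FKG** for decreasing events and finite intersections under `φ_{p,q}`, `q ≥ 1`
  (`rcMeasure_fkg_holds` of `RandomClusterFKG.lean`, on complements):
  `φ(∀ a ∈ A, c ∈ C : a ↮ c) ≥ ∏_{a ∈ A} ∏_{c ∈ C} (1 - φ(a ↔ c))` (`prod_prod_le_rcMeasure_disconnected`).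
* §5 **The deconfinement (perimeter-type) lower bound** (Aizenman 2025, §9.3, proof of Thm 9.1, and
  Lemma 9.3): with the Edwards–Sokal identity `φ(a ↔ c) = ⟨σ_a σ_c⟩` (`edwardsSokal_twoPoint_holds`),
  `⟨μ_S⟩_{G,β} ≥ ∏_{a ∈ A} ∏_{c ∈ C} (1 - ⟨σ_a σ_c⟩_{G,β}) ≥ exp( (log(1-R)/R) ∑_{a ∈ A} ∑_{c ∈ C} ⟨σ_a σ_c⟩_{G,β})`
  for any finite sets `A ⊇ wall₁`, `C ⊇ wall₂` and any `R ∈ (0,1)` dominating the two-point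
  functions involved (`prod_one_sub_twoPoint_le_isingExpect_disorderWeight`,
  `exp_mul_sum_twoPoint_le_isingExpect_disorderWeight`); such an `R` exists in finite volume
  (`isingTwoPoint_lt_one`).

* §6 **The three-dimensional instance**: on any finite region `Λ ⊆ ℤ³` with the induced
  nearest-neighbour graph (`regionGraph Λ`), the vertical bonds piercing a horizontal square of
  footprint `F` (`piercingBonds Λ F`) are transversal to the cylinder over `F` coloured by
  "above the square" (`isTransversal_piercingBonds`), whence Aizenman's displayed bound with the
  two lateral walls of the cylinder (`prod_one_sub_twoPoint_le_disorder_square`,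
  `exp_mul_sum_twoPoint_le_disorder_square`).

In `d = 3` (dual Ising box `Λ*`, `S` = the vertical bonds piercing an `ℓ × ℓ` square, `Γ` the
cylinder over the square, `h` = above/below, walls = the lateral boundary of the cylinder above and
below the square) §5 is the displayed chain of inequalities in Aizenman's proof of Thm 9.1 (§9.3); combined with the exponential decay of the dual Ising
two-point function for `β* < β_c^{Ising}` (Aizenman–Barsky–Fernández 1987) the double sum is
`O(per(γ_ℓ))` and the chain gives the perimeter law of Aizenman 2025 Thm 9.1, second line — an
infinite-volume statement NOT typed here. The area-law half of Thm 9.1 is Lebowitz–Pfister 1981.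
Nothing here bears on four-dimensional Yang–Mills.

`-- TODO(general form)`: Aizenman's Thm 7.2 is printed for arbitrary real couplings `J_b` and a
field `h`; the tree's `isingMeasure` has unit couplings, so only the coupling patterns `T_S(1)` are
typed (which is what Thm 8.1 / §9 use).

## References

* M. Aizenman, *Geometric analysis of Ising models, Part III*, Math. Phys. Anal. Geom. 28 (2025),
  arXiv:2509.02850: Def. 7.1, Thm 7.2, Thm 8.1, §9.1 Thm 9.1, §9.2 Thm 9.2, §9.3 Lemma 9.3 and
  proof of Thm 9.1 [Aizenman2025]; theorem numbering of arXiv v1.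
* M. Aizenman, J. T. Chayes, L. Chayes, J. Fröhlich, L. Russo, Commun. Math. Phys. 92 (1983)
  19–69, §3 i) (the finite-cluster ∕ FKG argument for the perimeter law, Lemma 3.1 and Thm 3.2,
  here in its FK-Ising form) [AizenmanChayesChayesFrohlichRusso1983].
* G. Grimmett, *The Random-Cluster Model* (2006), Thm 1.16 (Edwards–Sokal), Thm 3.8 (FKG)
  [Grimmett2006].
-/

namespace Literature.Probability.LatticeModels

open MeasureTheory Finset
open scoped ENNReal

namespace DisorderFK

variable {V : Type*}

/-! ### §1 Sign-reversed bonds and frustration -/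

section Signs

variable [DecidableEq V]

/-- The sign `ε_S(e)` of the coupling of the bond `e` after the disorder operator `T_S` has acted:
`-1` on `S`, `+1` off `S` (Aizenman 2025, §8, eq. (T_S J)_b = ∓J_b). [cite: Aizenman2025, §8 (definition of T_S)] -/
def edgeSign (S : Finset (Sym2 V)) (e : Sym2 V) : ℝ := if e ∈ S then -1 else 1

omit [DecidableEq V] in
/-- `ε_S(e) = -1` on `S`. [cite: Aizenman2025, §8 (definition of T_S)] -/
@[simp] theorem edgeSign_of_mem [DecidableEq V] {S : Finset (Sym2 V)} {e : Sym2 V} (h : e ∈ S) :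
    edgeSign S e = -1 := if_pos h

omit [DecidableEq V] in
/-- `ε_S(e) = 1` off `S`. [cite: Aizenman2025, §8 (definition of T_S)] -/
@[simp] theorem edgeSign_of_not_mem [DecidableEq V] {S : Finset (Sym2 V)} {e : Sym2 V} (h : e ∉ S) :
    edgeSign S e = 1 := if_neg h

/-- `ε_S(e) ∈ {1, -1}`. [cite: Aizenman2025, §8 (definition of T_S)] -/
theorem edgeSign_eq_one_or (S : Finset (Sym2 V)) (e : Sym2 V) :
    edgeSign S e = 1 ∨ edgeSign S e = -1 := by
  unfold edgeSign; split_ifs <;> simp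

/-- `ε_S(e)² = 1`. [cite: Aizenman2025, §8 (definition of T_S)] -/
theorem edgeSign_mul_self (S : Finset (Sym2 V)) (e : Sym2 V) : edgeSign S e * edgeSign S e = 1 := by
  rcases edgeSign_eq_one_or S e with h | h <;> rw [h] <;> norm_num

/-- `ε_S(e) ≠ 0`. [cite: Aizenman2025, §8 (definition of T_S)] -/
theorem edgeSign_ne_zero (S : Finset (Sym2 V)) (e : Sym2 V) : edgeSign S e ≠ 0 := by
  rcases edgeSign_eq_one_or S e with h | h <;> rw [h] <;> norm_num

/-- **Frustration-free configurations** (Aizenman 2025, Def. 7.1, for the coupling pattern `T_S J`,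
`J ≡ 1`), in the "consistent relative parity" form of the remark after Def. 7.1: the bond
configuration `ω` is `S`-unfrustrated if there is a spin assignment which is parallel across every
open bond off `S` and antiparallel across every open bond in `S`. Equivalent to the printed
closed-loop form, `unfrustrated_eq_loopEven`. [cite: Aizenman2025, Def. 7.1] -/
def IsUnfrustrated (S : Finset (Sym2 V)) (ω : Percolation.BondConfig V) : Prop :=
  ∃ σ : SpinConfig V, ∀ ⦃a b : V⦄, (Percolation.openGraph ω).Adj a b → (σ a = σ b ↔ s(a, b) ∉ S)

/-- The event "`ω` is `S`-frustration-free" (Aizenman 2025, Def. 7.1). [cite: Aizenman2025, Def. 7.1] -/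
def unfrustrated (S : Finset (Sym2 V)) : Set (Percolation.BondConfig V) := {ω | IsUnfrustrated S ω}

omit [DecidableEq V] in
/-- Membership in `unfrustrated S`. [cite: Aizenman2025, Def. 7.1] -/
@[simp] theorem mem_unfrustrated [DecidableEq V] {S : Finset (Sym2 V)} {ω : Percolation.BondConfig V} :
    ω ∈ unfrustrated S ↔ IsUnfrustrated S ω := Iff.rfl

/-- The number of sign-reversed bonds (bonds of `S`) along a walk (Aizenman 2025, Def. 7.1: "closed
loops supported on `ω` include only even numbers of edges with `J_b < 0`"). [cite: Aizenman2025, Def. 7.1] -/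
def negCount (S : Finset (Sym2 V)) {H : SimpleGraph V} {u v : V} (w : H.Walk u v) : ℕ :=
  w.edges.countP (· ∈ S)

/-- The printed frustration-free event: every closed walk along open bonds contains an even number
of bonds of `S` (Aizenman 2025, Def. 7.1). [cite: Aizenman2025, Def. 7.1] -/
def loopEven (S : Finset (Sym2 V)) : Set (Percolation.BondConfig V) :=
  {ω | ∀ (u : V) (w : (Percolation.openGraph ω).Walk u u), Even (negCount S w)}

omit [DecidableEq V] in
/-- Two units of `ℤ` differ iff one is the negative of the other. [folklore] -/
private theorem units_ne_iff_eq_neg (a b : ℤˣ) : a ≠ b ↔ a = -b := by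
  rcases Int.units_eq_one_or a with rfl | rfl <;> rcases Int.units_eq_one_or b with rfl | rfl <;> decide

/-- `negCount` of a one-step extension. [cite: Aizenman2025, Def. 7.1] -/
theorem negCount_cons (S : Finset (Sym2 V)) {H : SimpleGraph V} {u v w : V} (h : H.Adj u v)
    (p : H.Walk v w) :
    negCount S (SimpleGraph.Walk.cons h p) = negCount S p + if s(u, v) ∈ S then 1 else 0 := by
  unfold negCount
  rw [SimpleGraph.Walk.edges_cons, List.countP_cons]
  simp

/-- `negCount` is additive under concatenation. [cite: Aizenman2025, Def. 7.1] -/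
theorem negCount_append (S : Finset (Sym2 V)) {H : SimpleGraph V} {u v w : V} (p : H.Walk u v)
    (q : H.Walk v w) : negCount S (p.append q) = negCount S p + negCount S q := by
  unfold negCount
  rw [SimpleGraph.Walk.edges_append, List.countP_append]

/-- `negCount` is invariant under reversal. [cite: Aizenman2025, Def. 7.1] -/
theorem negCount_reverse (S : Finset (Sym2 V)) {H : SimpleGraph V} {u v : V} (p : H.Walk u v) :
    negCount S p.reverse = negCount S p := by
  unfold negCount
  rw [SimpleGraph.Walk.edges_reverse]
  exact (List.reverse_perm _).countP_eq _

/-- `negCount` is invariant under `Walk.copy`. [cite: Aizenman2025, Def. 7.1] -/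
theorem negCount_copy (S : Finset (Sym2 V)) {H : SimpleGraph V} {u v u' v' : V} (p : H.Walk u v)
    (hu : u = u') (hv : v = v') : negCount S (p.copy hu hv) = negCount S p := by
  subst hu hv; rfl

/-- **Relative parity along a walk** (Aizenman 2025, remark after Def. 7.1: "the parity of
`ω`-connection is the `±1` parity of the numbers of negative edges along paths"): a spin assignment
consistent with the signs has `σ_u = σ_v` iff the walk from `u` to `v` uses an even number of bonds
of `S`. [cite: Aizenman2025, Def. 7.1 and the remark following it] -/
theorem eq_iff_even_negCount (S : Finset (Sym2 V)) {H : SimpleGraph V} {σ : SpinConfig V}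
    (hσ : ∀ ⦃a b : V⦄, H.Adj a b → (σ a = σ b ↔ s(a, b) ∉ S)) :
    ∀ {u v : V} (w : H.Walk u v), σ u = σ v ↔ Even (negCount S w) := by
  intro u v w
  induction w with
  | nil => simp [negCount]
  | @cons a b c hadj p ih =>
    rw [negCount_cons]
    by_cases hS : s(a, b) ∈ S
    · rw [if_pos hS]
      have hab : σ a = -σ b := (units_ne_iff_eq_neg _ _).1 fun h => ((hσ hadj).1 h) hS
      rw [hab, Nat.even_add_one, ← ih]
      constructor
      · intro h1 h2
        rw [h2] at h1
        exact (units_ne_iff_eq_neg (σ c) (σ c)).2 h1.symm rfl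
      · intro h
        exact ((units_ne_iff_eq_neg _ _).1 (Ne.symm h)).symm ▸ rfl
    · rw [if_neg hS, add_zero, (hσ hadj).2 hS]
      exact ih

/-- **Consistent spins exclude odd loops** (the easy half of the equivalence in Aizenman 2025,
Def. 7.1). [cite: Aizenman2025, Def. 7.1] -/
theorem unfrustrated_subset_loopEven (S : Finset (Sym2 V)) :
    unfrustrated S ⊆ loopEven S := by
  rintro ω ⟨σ, hσ⟩ u w
  exact (eq_iff_even_negCount S hσ w).1 rfl

/-- **No odd loops gives consistent spins** (the other half of Aizenman 2025, Def. 7.1 /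
"consistency of this definition for all `u, v` is equivalent to `ω` being frustration free";
Harary's balance criterion): define `σ_x` by the parity of the `S`-bonds along a chosen open walk
from a chosen root of the cluster of `x`. [cite: Aizenman2025, Def. 7.1 and the remark following it] -/
theorem loopEven_subset_unfrustrated (S : Finset (Sym2 V)) :
    loopEven S ⊆ unfrustrated S := by
  classical
  intro ω hω
  set H : SimpleGraph V := Percolation.openGraph ω with hH
  -- a root for every cluster and a walk from the root
  let r : V → V := fun x => (H.connectedComponentMk x).out
  have hr : ∀ x, H.Reachable (r x) x := fun x => by
    have h1 : H.connectedComponentMk (r x) = H.connectedComponentMk x := Quot.out_eq _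
    exact SimpleGraph.ConnectedComponent.exact h1
  let px : ∀ x, H.Walk (r x) x := fun x => (hr x).some
  refine ⟨fun x => if Even (negCount S (px x)) then 1 else -1, ?_⟩
  intro a b hab
  have hrab : r a = r b :=
    congrArg (fun c : H.ConnectedComponent => c.out)
      (SimpleGraph.ConnectedComponent.connectedComponentMk_eq_of_adj hab)
  -- the closed walk root → a → b → root
  let W : H.Walk (r a) (r a) :=
    ((px a).append (SimpleGraph.Walk.cons hab (px b).reverse)).copy rfl hrab.symm
  have hW : Even (negCount S W) := hω (r a) W
  have hWcount : negCount S W =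
      negCount S (px a) + (negCount S (px b) + if s(a, b) ∈ S then 1 else 0) := by
    simp only [W, negCount_copy, negCount_append, negCount_cons, negCount_reverse]
  rw [hWcount] at hW
  by_cases hS : s(a, b) ∈ S
  · rw [if_pos hS] at hW
    -- parities of the two root walks differ
    have hdiff : Even (negCount S (px a)) ↔ ¬ Even (negCount S (px b)) := by
      rw [← add_assoc, Nat.even_add_one, Nat.even_add] at hW
      tauto
    simp only [hS, not_true_eq_false, iff_false]
    by_cases ha : Even (negCount S (px a))
    · have hb : ¬ Even (negCount S (px b)) := hdiff.1 ha
      simp only [ha, hb, if_true, if_false]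
      decide
    · have hb : Even (negCount S (px b)) := by
        by_contra hb; exact ha (hdiff.2 hb)
      simp only [ha, hb, if_true, if_false]
      decide
  · rw [if_neg hS, add_zero] at hW
    have hsame : Even (negCount S (px a)) ↔ Even (negCount S (px b)) := by
      rw [Nat.even_add] at hW; exact hW
    simp only [hS, not_false_eq_true, iff_true]
    by_cases ha : Even (negCount S (px a))
    · simp only [ha, hsame.1 ha, if_true]
    · have hb : ¬ Even (negCount S (px b)) := fun hb => ha (hsame.2 hb)
      simp only [ha, hb, if_false]

/-- **The two forms of "frustration free" agree** (Aizenman 2025, Def. 7.1 and the remark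
following it). [cite: Aizenman2025, Def. 7.1] -/
theorem unfrustrated_eq_loopEven (S : Finset (Sym2 V)) : unfrustrated S = loopEven S :=
  Set.Subset.antisymm (unfrustrated_subset_loopEven S) (loopEven_subset_unfrustrated S)

end Signs

/-! ### §2 The FK representation of the disorder operator (Aizenman 2025, Thm 7.2 / Thm 8.1) -/

section FK

variable [Fintype V] [DecidableEq V] (G : SimpleGraph V) [DecidableRel G.Adj]

omit [Fintype V] [DecidableEq V] in
/-- Spin products are multiplicative under the pointwise product of configurations. [folklore] -/
private theorem bondSpin_mul (σ τ : SpinConfig V) (e : Sym2 V) :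
    bondSpin (σ * τ) e = bondSpin σ e * bondSpin τ e := by
  induction e using Sym2.ind with
  | _ a b =>
    simp only [bondSpin_mk, spinAt, Pi.mul_apply, Units.val_mul, Int.cast_mul]
    ring

omit [Fintype V] in
/-- For a bond configuration without loops (e.g. `ω ⊆ E(G)`), the bondwise sign condition
`σ_e = ε_S(e) ∀ e ∈ ω` is the consistency condition of `IsUnfrustrated`. [cite: Aizenman2025, Def. 7.1] -/
theorem forall_bondSpin_eq_edgeSign_iff (S : Finset (Sym2 V)) {ω : Finset (Sym2 V)}
    (hω : ∀ e ∈ ω, ¬ e.IsDiag) (σ : SpinConfig V) :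
    (∀ e ∈ ω, bondSpin σ e = edgeSign S e) ↔
      ∀ ⦃a b : V⦄, (Percolation.openGraph (↑ω : Percolation.BondConfig V)).Adj a b →
        (σ a = σ b ↔ s(a, b) ∉ S) := by
  constructor
  · intro h a b hab
    rw [Percolation.openGraph_adj, Finset.mem_coe] at hab
    have h1 := h _ hab.1
    rw [← bondSpin_mk_eq_one_iff σ a b, h1]
    unfold edgeSign; split_ifs with hS <;> norm_num [hS]
  · intro h e he
    induction e using Sym2.ind with
    | _ a b =>
      have hab : a ≠ b := fun h' => hω _ he (by subst h'; exact Sym2.mk_isDiag_iff.2 rfl)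
      have h1 := h ((Percolation.openGraph_adj _ a b).2 ⟨Finset.mem_coe.2 he, hab⟩)
      by_cases hS : s(a, b) ∈ S
      · rw [edgeSign_of_mem hS]
        have hne : σ a ≠ σ b := fun h' => (h1.1 h') hS
        have hne' : bondSpin σ s(a, b) ≠ 1 := fun h' => hne ((bondSpin_mk_eq_one_iff σ a b).1 h')
        rcases spinAt_eq_one_or_eq_neg_one a σ with ha | ha <;>
          rcases spinAt_eq_one_or_eq_neg_one b σ with hb | hb <;>
          simp_all [bondSpin_mk]
      · rw [edgeSign_of_not_mem hS]
        exact (bondSpin_mk_eq_one_iff σ a b).2 (h1.2 hS)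

/-- **Counting sign-consistent configurations** (Aizenman 2025, proof of Thm 7.2: "the constraint
restricts the values of spins in a manner which cannot be satisfied unless `ω` is frustration free,
and if it is then it allows exactly two spin configurations within each `ω`-connected cluster"):
`∑_σ 1{σ_e = ε_S(e) ∀ e ∈ ω} = 2^{k(ω)} 1[ω unfrustrated]`. Multiplying by one solution maps the
solutions bijectively onto the cluster-constant configurations, counted by `sum_boole_bondSpin_eq`.
[cite: Aizenman2025, Thm 7.2 (proof)] -/
theorem sum_boole_bondSpin_eq_edgeSign (S : Finset (Sym2 V)) {ω : Finset (Sym2 V)}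
    [Decidable (IsUnfrustrated S (↑ω : Percolation.BondConfig V))]
    (hω : ∀ e ∈ ω, ¬ e.IsDiag) :
    ∑ σ : SpinConfig V, (if ∀ e ∈ ω, bondSpin σ e = edgeSign S e then (1 : ℝ) else 0) =
      if IsUnfrustrated S (↑ω : Percolation.BondConfig V) then
        (2 : ℝ) ^ clusterCount (↑ω : Percolation.BondConfig V) ∅ else 0 := by
  classical
  by_cases hU : IsUnfrustrated S (↑ω : Percolation.BondConfig V)
  · rw [if_pos hU]
    obtain ⟨σ₀, hσ₀⟩ := hU
    have h₀ : ∀ e ∈ ω, bondSpin σ₀ e = edgeSign S e :=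
      (forall_bondSpin_eq_edgeSign_iff S hω σ₀).2 hσ₀
    -- reindex `σ ↦ σ * σ₀`
    have key : ∀ σ : SpinConfig V,
        (∀ e ∈ ω, bondSpin (σ * σ₀) e = edgeSign S e) ↔ ∀ e ∈ ω, bondSpin σ e = 1 := by
      intro σ
      refine forall₂_congr fun e he => ?_
      rw [bondSpin_mul, h₀ e he]
      constructor
      · intro h
        have := congrArg (· * edgeSign S e) h
        simp only [mul_assoc, edgeSign_mul_self, mul_one] at this
        exact this
      · intro h; rw [h, one_mul]
    rw [← sum_boole_bondSpin_eq ω]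
    rw [← Fintype.sum_equiv (Equiv.mulRight σ₀)
      (fun σ => if ∀ e ∈ ω, bondSpin (σ * σ₀) e = edgeSign S e then (1 : ℝ) else 0)
      (fun σ => if ∀ e ∈ ω, bondSpin σ e = edgeSign S e then (1 : ℝ) else 0)
      (fun σ => rfl)]
    exact Finset.sum_congr rfl fun σ _ => by simp only [key]
  · rw [if_neg hU]
    refine Finset.sum_eq_zero fun σ _ => ?_
    rw [if_neg]
    intro h
    exact hU ⟨σ, (forall_bondSpin_eq_edgeSign_iff S hω σ).1 h⟩

omit [Fintype V] in
/-- The Edwards–Sokal edge identity with a reversed coupling: for `±1` spins and `ε ∈ {±1}`,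
`exp(β ε σ_e) = e^{β} ((1 - p) + p 1{σ_e = ε})`, `p = 1 - e^{-2β}` (Grimmett 2006, §1.4,
eq. (1.17), applied to the coupling `ε`). [cite: Grimmett2006, §1.4 eq. (1.17); Aizenman2025 Thm 7.2 (proof)] -/
theorem exp_mul_edgeSign_bondSpin_eq (S : Finset (Sym2 V)) (β : ℝ) (σ : SpinConfig V) (e : Sym2 V) :
    Real.exp (β * (edgeSign S e * bondSpin σ e)) =
      Real.exp β * (fkIsingParam β * (if bondSpin σ e = edgeSign S e then 1 else 0) +
        (1 - fkIsingParam β)) := by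
  have hb : bondSpin σ e = 1 ∨ bondSpin σ e = -1 := by
    induction e using Sym2.ind with
    | _ a b =>
      rw [bondSpin_mk]
      rcases spinAt_eq_one_or_eq_neg_one a σ with ha | ha <;>
        rcases spinAt_eq_one_or_eq_neg_one b σ with hb | hb <;> simp [ha, hb]
  have key : ∀ t : ℝ, (t = 1 ∨ t = -1) →
      Real.exp (β * t) = Real.exp β * (fkIsingParam β * (if t = 1 then 1 else 0) +
        (1 - fkIsingParam β)) := by
    rintro t (rfl | rfl)
    · simp [fkIsingParam]
    · rw [if_neg (by norm_num)]
      simp only [fkIsingParam, mul_zero, zero_add, sub_sub_cancel, mul_neg, mul_one]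
      rw [← Real.exp_add]; congr 1; ring
  rcases edgeSign_eq_one_or S e with hs | hs
  · rw [hs, one_mul]
    exact key _ hb
  · rw [hs, neg_one_mul]
    have hb' : -bondSpin σ e = 1 ∨ -bondSpin σ e = -1 := by
      rcases hb with h | h <;> simp [h]
    rw [key _ hb']
    rcases hb with h | h <;> norm_num [h]

/-- Expanding the sign-reversed Boltzmann weight over edge subsets (Grimmett 2006, eq. (1.18), with
the couplings `ε_S`): `exp(β ∑_{e ∈ E} ε_S(e) σ_e) = e^{β|E|} ∑_{ω ⊆ E} p^{|ω|} (1-p)^{|E ∖ ω|}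
1{σ_e = ε_S(e) ∀ e ∈ ω}`. [cite: Grimmett2006, §1.4 eq. (1.18); Aizenman2025 Thm 7.2 (proof)] -/
theorem exp_mul_sum_edgeSign_bondSpin_eq (S : Finset (Sym2 V)) (β : ℝ) (σ : SpinConfig V) :
    Real.exp (β * ∑ e ∈ G.edgeFinset, edgeSign S e * bondSpin σ e) =
      Real.exp β ^ #G.edgeFinset *
        ∑ ω ∈ G.edgeFinset.powerset,
          fkIsingParam β ^ #ω * (1 - fkIsingParam β) ^ #(G.edgeFinset \ ω) *
            (if ∀ e ∈ ω, bondSpin σ e = edgeSign S e then 1 else 0) := by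
  rw [Finset.mul_sum, Real.exp_sum]
  simp_rw [exp_mul_edgeSign_bondSpin_eq S β σ]
  rw [Finset.prod_mul_distrib, Finset.prod_const, Finset.prod_add]
  congr 1
  refine Finset.sum_congr rfl fun ω _ => ?_
  rw [Finset.prod_mul_distrib, Finset.prod_const, Finset.prod_const, Finset.prod_boole]
  ring

omit [Fintype V] in
/-- The disorder insertion reverses the couplings on `S ⊆ E`:
`e^{β ∑_E σ_e} μ_S(σ) = e^{β ∑_E ε_S(e) σ_e}`. [cite: Aizenman2025, §8 (definition of ⟨T_S⟩ as a ratio of partition functions)] -/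
theorem exp_mul_sum_bondSpin_mul_disorderWeight (S : Finset (Sym2 V)) {E : Finset (Sym2 V)}
    (hS : S ⊆ E) (β : ℝ) (σ : SpinConfig V) :
    Real.exp (β * ∑ e ∈ E, bondSpin σ e) * disorderWeight β S σ =
      Real.exp (β * ∑ e ∈ E, edgeSign S e * bondSpin σ e) := by
  rw [disorderWeight_eq_exp_sum, ← Real.exp_add]
  congr 1
  have h1 : ∀ e ∈ E, edgeSign S e * bondSpin σ e =
      bondSpin σ e - 2 * (if e ∈ S then bondSpin σ e else 0) := by
    intro e _
    unfold edgeSign; split_ifs <;> ring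
  rw [Finset.sum_congr rfl h1, Finset.sum_sub_distrib, ← Finset.mul_sum, Finset.sum_ite_mem,
    Finset.inter_eq_right.2 hS]
  ring

/-- The free-boundary partition sum of the finite graph in FK form (Grimmett 2006, Thm 1.10(c) at
`q = 2`): `∑_σ e^{β ∑_E σ_e} = e^{β|E|} Z^{FK}_{G,p,2}`. [cite: Grimmett2006, §1.4 Thm 1.10] -/
theorem sum_exp_mul_sum_bondSpin_eq (β : ℝ) :
    ∑ σ : SpinConfig V, Real.exp (β * ∑ e ∈ G.edgeFinset, bondSpin σ e) =
      Real.exp β ^ #G.edgeFinset * rcPartitionFunction G (fkIsingParam β) 2 ∅ := by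
  simp_rw [exp_mul_sum_bondSpin_eq G β]
  rw [← Finset.mul_sum, Finset.sum_comm]
  congr 1
  unfold rcPartitionFunction
  refine Finset.sum_congr rfl fun ω _ => ?_
  rw [← Finset.mul_sum, sum_boole_bondSpin_eq, rcWeight]

/-- The sign-reversed partition sum in FK form (Aizenman 2025, Thm 7.2, first display, for the
pattern `T_S J`): `∑_σ e^{β ∑_E ε_S σ_e} = e^{β|E|} ∑_{ω ⊆ E} w_{p,2}(ω) 1[ω S-unfrustrated]`. [cite: Aizenman2025, Thm 7.2] -/
theorem sum_exp_mul_sum_edgeSign_bondSpin_eq {S : Finset (Sym2 V)} (hS : S ⊆ G.edgeFinset) (β : ℝ)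
    [DecidablePred fun ω : Finset (Sym2 V) => IsUnfrustrated S (↑ω : Percolation.BondConfig V)] :
    ∑ σ : SpinConfig V, Real.exp (β * ∑ e ∈ G.edgeFinset, edgeSign S e * bondSpin σ e) =
      Real.exp β ^ #G.edgeFinset *
        ∑ ω ∈ G.edgeFinset.powerset,
          if IsUnfrustrated S (↑ω : Percolation.BondConfig V) then
            rcWeight G (fkIsingParam β) 2 ∅ ω else 0 := by
  have _ := hS
  simp_rw [exp_mul_sum_edgeSign_bondSpin_eq G S β]
  rw [← Finset.mul_sum, Finset.sum_comm]
  congr 1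
  refine Finset.sum_congr rfl fun ω hω => ?_
  have hωd : ∀ e ∈ ω, ¬ e.IsDiag := fun e he =>
    SimpleGraph.not_isDiag_of_mem_edgeSet G
      (SimpleGraph.mem_edgeFinset.1 (Finset.mem_powerset.1 hω he))
  rw [← Finset.mul_sum, sum_boole_bondSpin_eq_edgeSign S hωd]
  by_cases hU : IsUnfrustrated S (↑ω : Percolation.BondConfig V)
  · rw [if_pos hU, if_pos hU, rcWeight]
  · rw [if_neg hU, if_neg hU, mul_zero]

/-- **The FK representation of the disorder operator** (Aizenman 2025, Thm 8.1, FK line; = Thm 7.2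
for the couplings `T_S J`, `J ≡ 1`): for the free-boundary, zero-field Ising model on a finite
graph at `β ≥ 0` and `S ⊆ E`,
`⟨T_S⟩_{G,β} = ⟨μ_S⟩_{G,β} = φ_{G, 1 - e^{-2β}, 2}(ω is S-frustration-free)`.
[cite: Aizenman2025, Thm 8.1 and Thm 7.2] -/
theorem isingExpect_disorderWeight_eq_rcMeasure_unfrustrated {β : ℝ} (hβ : 0 ≤ β)
    {S : Finset (Sym2 V)} (hS : S ⊆ G.edgeFinset) :
    isingExpect G univ β 0 .free (disorderWeight β S) =
      (rcMeasure G (fkIsingParam β) 2 ∅).real (unfrustrated S) := by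
  classical
  have hp : fkIsingParam β ∈ Set.Icc (0 : ℝ) 1 := fkIsingParam_mem_Icc hβ
  have hq : (0 : ℝ) < 2 := two_pos
  have hZ := rcPartitionFunction_pos G hp hq ∅
  have hc : (0 : ℝ) < Real.exp β ^ #G.edgeFinset := pow_pos (Real.exp_pos β) _
  rw [isingExpect_univ_free_eq G β (measurable_disorderWeight β S)]
  simp_rw [exp_mul_sum_bondSpin_mul_disorderWeight S hS β]
  rw [sum_exp_mul_sum_edgeSign_bondSpin_eq G hS β, sum_exp_mul_sum_bondSpin_eq G β,
    mul_div_mul_left _ _ hc.ne', rcMeasure_real_apply G hp hq ∅ (unfrustrated S), Finset.sum_div]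
  refine Finset.sum_congr rfl fun ω _ => ?_
  simp only [mem_unfrustrated]
  split_ifs <;> simp

end FK

/-! ### §3 The cylinder criterion: disconnected walls force frustration-freeness -/

section Cylinder

variable (G : SimpleGraph V)

/-- The **wall** of colour `c` of the region `Γ` two-coloured by `h`: the vertices of `Γ` of colour
`c` having a `G`-neighbour outside `Γ` (Aizenman 2025, §9.3: the two parts `(∂Γ_ℓ)₁`, `(∂Γ_ℓ)₂` into
which the boundary of the cylinder `Γ_ℓ` is cut by the surface). [cite: Aizenman2025, §9.3 (definition of (∂Γ_ℓ)_{1,2})] -/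
def wall (Γ : Set V) (h : V → Bool) (c : Bool) : Set V :=
  {x | x ∈ Γ ∧ h x = c ∧ ∃ y, y ∉ Γ ∧ G.Adj x y}

/-- `S` is **transversal** to the two-coloured region `(Γ, h)`: every bond of `S` joins the two
colour classes inside `Γ`, and every bond of `G` inside `Γ` joining the two colour classes lies in
`S` (Aizenman 2025, §9.3, "by the geometry of this setup": inside the cylinder over the square the
only bonds crossing the plane of the square are those piercing the square). [cite: Aizenman2025, §9.3 (the geometry of Γ_ℓ and S_ℓ)] -/
structure IsTransversal (S : Finset (Sym2 V)) (Γ : Set V) (h : V → Bool) : Prop where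
  /-- bonds of `S` join the two classes inside `Γ` -/
  mem_of_mem : ∀ ⦃x y : V⦄, s(x, y) ∈ S → x ∈ Γ ∧ y ∈ Γ ∧ h x ≠ h y
  /-- two-coloured bonds inside `Γ` are in `S` -/
  mem_of_adj : ∀ ⦃x y : V⦄, G.Adj x y → x ∈ Γ → y ∈ Γ → h x ≠ h y → s(x, y) ∈ S

/-- The event "no open path joins the two walls" (Aizenman 2025, §9.3, proof of Thm 9.1:
`(∂Γ_ℓ)₁ ↮ (∂Γ_ℓ)₂`). [cite: Aizenman2025, §9.3 (proof of Thm 9.1)] -/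
def wallsDisconnected (Γ : Set V) (h : V → Bool) : Set (Percolation.BondConfig V) :=
  {ω | ∀ x ∈ wall G Γ h true, ∀ z ∈ wall G Γ h false, ¬ (Percolation.openGraph ω).Reachable x z}

variable {G}

/-- **Exit lemma.** Along the open bonds off `S`, a walk ending at a vertex `y ∈ Γ` and starting
either outside `Γ` or inside `Γ` with the other colour reaches the wall of the colour of `y` (inside
`Γ` the open bonds off `S` are monochromatic, so the walk must enter `Γ` through that wall)
(Aizenman 2025, §9.3, the geometric step). [cite: Aizenman2025, §9.3 (proof of Thm 9.1, geometric step)] -/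
theorem exists_wall_reachable {S : Finset (Sym2 V)} {Γ : Set V} {h : V → Bool}
    (hT : IsTransversal G S Γ h) {ω : Percolation.BondConfig V} (hω : ω ⊆ G.edgeSet) :
    ∀ {u y : V} (_ : (Percolation.openGraph (ω \ ↑S)).Walk u y), y ∈ Γ →
      (u ∉ Γ ∨ (u ∈ Γ ∧ h u ≠ h y)) →
        ∃ z ∈ wall G Γ h (h y), (Percolation.openGraph (ω \ ↑S)).Reachable u z := by
  intro u y w
  induction w with
  | nil =>
    intro hy hu
    rcases hu with hu | ⟨-, hne⟩
    · exact (hu hy).elim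
    · exact (hne rfl).elim
  | @cons a b c hadj p ih =>
    intro hc hu
    have hadj' := (Percolation.openGraph_adj _ a b).1 hadj
    have hmem : s(a, b) ∈ ω ∧ s(a, b) ∉ (↑S : Set (Sym2 V)) := hadj'.1
    have hG : G.Adj a b := by
      have := hω hmem.1
      rwa [SimpleGraph.mem_edgeSet] at this
    by_cases hb : b ∈ Γ
    · by_cases hbc : h b = h c
      · rcases hu with ha | ⟨ha, hne⟩
        · refine ⟨b, ⟨hb, hbc, a, ha, hG.symm⟩, hadj.reachable⟩
        · exfalso
          have hab : h a ≠ h b := by rw [hbc]; exact hne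
          exact hmem.2 (Finset.mem_coe.2 (hT.mem_of_adj hG ha hb hab))
      · obtain ⟨z, hz, hreach⟩ := ih hc (Or.inr ⟨hb, hbc⟩)
        exact ⟨z, hz, hadj.reachable.trans hreach⟩
    · obtain ⟨z, hz, hreach⟩ := ih hc (Or.inl hb)
      exact ⟨z, hz, hadj.reachable.trans hreach⟩

/-- **Disconnected walls force frustration-freeness** (Aizenman 2025, §9.3: "the parity condition
… is certainly satisfied for any edge set `ω` for which the two parts of the cylindrical set's
boundary are not `ω`-connected"): for `S` transversal to `(Γ, h)` and `ω ⊆ E(G)` with no open path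
between the two walls, `ω` is `S`-unfrustrated. The consistent spin assignment is
`σ_x = +1` iff `x` is joined to a `true`-coloured vertex of `Γ` by open bonds off `S`.
[cite: Aizenman2025, §9.3 (proof of Thm 9.1, geometric step)] -/
theorem isUnfrustrated_of_wallsDisconnected {S : Finset (Sym2 V)} {Γ : Set V} {h : V → Bool}
    (hT : IsTransversal G S Γ h) {ω : Percolation.BondConfig V} (hω : ω ⊆ G.edgeSet)
    (hdis : ω ∈ wallsDisconnected G Γ h) : IsUnfrustrated S ω := by
  classical
  set K : SimpleGraph V := Percolation.openGraph (ω \ ↑S) with hK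
  have hKle : K ≤ Percolation.openGraph ω := Percolation.openGraph_mono fun e he => he.1
  let P : V → Prop := fun x => ∃ y, y ∈ Γ ∧ h y = true ∧ K.Reachable x y
  -- inside `Γ`, `P` is the colour
  have hP : ∀ x ∈ Γ, P x ↔ h x = true := by
    intro x hx
    constructor
    · rintro ⟨y, hy, hyc, hxy⟩
      by_contra hxc
      have hne : h x ≠ h y := by rw [hyc]; exact hxc
      obtain ⟨w⟩ := hxy
      obtain ⟨z, hz, hxz⟩ := exists_wall_reachable hT hω w hy (Or.inr ⟨hx, hne⟩)
      obtain ⟨z', hz', hyz'⟩ := exists_wall_reachable hT hω w.reverse hx (Or.inr ⟨hy, hne.symm⟩)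
      have hzz' : K.Reachable z z' := (hxz.symm.trans w.reachable).trans hyz'
      rw [hyc] at hz
      have hxc' : h x = false := by simpa using hxc
      rw [hxc'] at hz'
      exact hdis z hz z' hz' (hzz'.mono hKle)
    · intro hxc
      exact ⟨x, hx, hxc, SimpleGraph.Reachable.refl x⟩
  refine ⟨fun x => if P x then 1 else -1, ?_⟩
  intro a b hab
  have hab' := (Percolation.openGraph_adj _ a b).1 hab
  by_cases hS : s(a, b) ∈ S
  · -- an `S`-bond: endpoints in `Γ` with different colours
    obtain ⟨ha, hb, hne⟩ := hT.mem_of_mem hS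
    have hPa := hP a ha
    have hPb := hP b hb
    simp only [hS, not_true_eq_false, iff_false]
    intro heq
    have hiff : P a ↔ P b := by
      by_cases hpa : P a <;> by_cases hpb : P b <;> simp_all
    apply hne
    rcases Bool.eq_false_or_eq_true (h a) with h1 | h1 <;>
      rcases Bool.eq_false_or_eq_true (h b) with h2 | h2 <;> simp_all
  · -- a bond off `S`: a `K`-bond, `P` is transported
    have hKab : K.Adj a b := by
      rw [hK, Percolation.openGraph_adj]
      exact ⟨⟨hab'.1, fun h' => hS (Finset.mem_coe.1 h')⟩, hab'.2⟩
    have hiff : P a ↔ P b := by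
      constructor
      · rintro ⟨y, hy, hyc, hr⟩; exact ⟨y, hy, hyc, hKab.symm.reachable.trans hr⟩
      · rintro ⟨y, hy, hyc, hr⟩; exact ⟨y, hy, hyc, hKab.reachable.trans hr⟩
    simp only [hS, not_false_eq_true, iff_true]
    by_cases hpa : P a
    · rw [if_pos hpa, if_pos (hiff.1 hpa)]
    · rw [if_neg hpa, if_neg (fun hpb => hpa (hiff.2 hpb))]

/-- Set form of `isUnfrustrated_of_wallsDisconnected` on the support `{ω ⊆ E(G)}` of the
random-cluster measure. [cite: Aizenman2025, §9.3 (proof of Thm 9.1, geometric step)] -/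
theorem wallsDisconnected_subset_unfrustrated [DecidableEq V] {S : Finset (Sym2 V)} {Γ : Set V}
    {h : V → Bool} (hT : IsTransversal G S Γ h) {ω : Percolation.BondConfig V} (hω : ω ⊆ G.edgeSet)
    (hdis : ω ∈ wallsDisconnected G Γ h) : ω ∈ unfrustrated S :=
  isUnfrustrated_of_wallsDisconnected hT hω hdis

end Cylinder

/-! ### §4 FKG for decreasing events under the random-cluster measure -/

section FKG

variable [Fintype V] [DecidableEq V] (G : SimpleGraph V) [DecidableRel G.Adj]

/-- Complements: `φ(Aᶜ) = 1 - φ(A)`. [cite: Grimmett2006, §1.2, eq. (1.2)] -/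
theorem rcMeasure_real_compl {p q : ℝ} (hp : p ∈ Set.Icc (0 : ℝ) 1) (hq : 0 < q) (B : Set V)
    (A : Set (Percolation.BondConfig V)) :
    (rcMeasure G p q B).real Aᶜ = 1 - (rcMeasure G p q B).real A := by
  classical
  have hZ := rcPartitionFunction_pos G hp hq B
  rw [rcMeasure_real_apply G hp hq B Aᶜ, rcMeasure_real_apply G hp hq B A]
  have h1 : ∀ ω ∈ G.edgeFinset.powerset,
      (if (↑ω : Percolation.BondConfig V) ∈ Aᶜ then
          rcWeight G p q B ω / rcPartitionFunction G p q B else 0) =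
        rcWeight G p q B ω / rcPartitionFunction G p q B -
          (if (↑ω : Percolation.BondConfig V) ∈ A then
            rcWeight G p q B ω / rcPartitionFunction G p q B else 0) := by
    intro ω _
    by_cases hA : (↑ω : Percolation.BondConfig V) ∈ A
    · rw [if_neg (fun h => h hA), if_pos hA, sub_self]
    · rw [if_pos (Set.mem_compl hA), if_neg hA, sub_zero]
  rw [Finset.sum_congr rfl h1, Finset.sum_sub_distrib, ← Finset.sum_div, ← rcPartitionFunction,
    div_self hZ.ne']

/-- **FKG for decreasing events** (Grimmett 2006, Thm 3.8, applied to complements): for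
`0 ≤ p ≤ 1`, `q ≥ 1` and decreasing `D, D'`, `φ(D) φ(D') ≤ φ(D ∩ D')`. [cite: Grimmett2006, Thm 3.8] -/
theorem rcMeasure_real_inter_ge_of_isLowerSet {p q : ℝ} (hp : p ∈ Set.Icc (0 : ℝ) 1) (hq : 1 ≤ q)
    (B : Set V) {D D' : Set (Percolation.BondConfig V)} (hD : IsLowerSet D) (hD' : IsLowerSet D') :
    (rcMeasure G p q B).real D * (rcMeasure G p q B).real D' ≤ (rcMeasure G p q B).real (D ∩ D') := by
  classical
  have hq0 : (0 : ℝ) < q := one_pos.trans_le hq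
  have hZ := rcPartitionFunction_pos G hp hq0 B
  have key := rcMeasure_fkg_holds G hp hq B hD.compl hD'.compl
  rw [rcMeasure_real_compl G hp hq0 B D, rcMeasure_real_compl G hp hq0 B D'] at key
  -- `φ(Dᶜ ∩ D'ᶜ) = 1 - φ(D) - φ(D') + φ(D ∩ D')` from the finite-sum formula
  have hIE : (rcMeasure G p q B).real (Dᶜ ∩ D'ᶜ) =
      1 - (rcMeasure G p q B).real D - (rcMeasure G p q B).real D' +
        (rcMeasure G p q B).real (D ∩ D') := by
    have h1 : (rcMeasure G p q B).real (Dᶜ ∩ D'ᶜ) = 1 - (rcMeasure G p q B).real (D ∪ D') := by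
      rw [← Set.compl_union, rcMeasure_real_compl G hp hq0 B]
    rw [h1, rcMeasure_real_apply G hp hq0 B (D ∪ D'), rcMeasure_real_apply G hp hq0 B D,
      rcMeasure_real_apply G hp hq0 B D', rcMeasure_real_apply G hp hq0 B (D ∩ D')]
    have h2 : ∀ ω ∈ G.edgeFinset.powerset,
        (if (↑ω : Percolation.BondConfig V) ∈ D ∪ D' then
            rcWeight G p q B ω / rcPartitionFunction G p q B else 0) =
          (if (↑ω : Percolation.BondConfig V) ∈ D then
              rcWeight G p q B ω / rcPartitionFunction G p q B else 0) +
            (if (↑ω : Percolation.BondConfig V) ∈ D' then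
              rcWeight G p q B ω / rcPartitionFunction G p q B else 0) -
            (if (↑ω : Percolation.BondConfig V) ∈ D ∩ D' then
              rcWeight G p q B ω / rcPartitionFunction G p q B else 0) := by
      intro ω _
      by_cases h₁ : (↑ω : Percolation.BondConfig V) ∈ D <;>
        by_cases h₂ : (↑ω : Percolation.BondConfig V) ∈ D' <;>
        simp [h₁, h₂]
    rw [Finset.sum_congr rfl h2, Finset.sum_sub_distrib, Finset.sum_add_distrib]
    ring
  rw [hIE] at key
  nlinarith [key]

/-- The random-cluster measure of the whole space is `1`. [cite: Grimmett2006, §1.2] -/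
theorem rcMeasure_real_univ {p q : ℝ} (hp : p ∈ Set.Icc (0 : ℝ) 1) (hq : 0 < q) (B : Set V) :
    (rcMeasure G p q B).real Set.univ = 1 := by
  haveI := isProbabilityMeasure_rcMeasure G hp hq B
  simp [measureReal_def]

/-- **FKG for finitely many decreasing events**: `∏_{i ∈ s} φ(D_i) ≤ φ(⋂_{i ∈ s} D_i)`
(Grimmett 2006, Thm 3.8, iterated). [cite: Grimmett2006, Thm 3.8] -/
theorem prod_rcMeasure_real_le_biInter {p q : ℝ} (hp : p ∈ Set.Icc (0 : ℝ) 1) (hq : 1 ≤ q)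
    (B : Set V) {ι : Type*} (s : Finset ι) (D : ι → Set (Percolation.BondConfig V))
    (hD : ∀ i ∈ s, IsLowerSet (D i)) :
    ∏ i ∈ s, (rcMeasure G p q B).real (D i) ≤ (rcMeasure G p q B).real (⋂ i ∈ s, D i) := by
  classical
  have hq0 : (0 : ℝ) < q := one_pos.trans_le hq
  induction s using Finset.induction_on with
  | empty =>
    simp only [Finset.prod_empty, Finset.notMem_empty, Set.iInter_of_empty, Set.iInter_univ]
    rw [rcMeasure_real_univ G hp hq0 B]
  | insert a s ha ih =>
    rw [Finset.prod_insert ha, Finset.set_biInter_insert]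
    have hDs : IsLowerSet (⋂ i ∈ s, D i) :=
      isLowerSet_iInter₂ fun i hi => hD i (Finset.mem_insert_of_mem hi)
    have hDa : IsLowerSet (D a) := hD a (Finset.mem_insert_self a s)
    calc (rcMeasure G p q B).real (D a) * ∏ i ∈ s, (rcMeasure G p q B).real (D i)
        ≤ (rcMeasure G p q B).real (D a) * (rcMeasure G p q B).real (⋂ i ∈ s, D i) :=
          mul_le_mul_of_nonneg_left (ih fun i hi => hD i (Finset.mem_insert_of_mem hi))
            measureReal_nonneg
      _ ≤ (rcMeasure G p q B).real (D a ∩ ⋂ i ∈ s, D i) :=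
          rcMeasure_real_inter_ge_of_isLowerSet G hp hq B hDa hDs

/-- **Disconnection events are positively correlated** (Aizenman 2025, §9.3, proof of Thm 9.1: "by
the FKG inequality … the non-connection events, being non-increasing in `ω`, are positively
correlated"): `∏_{a ∈ A} ∏_{c ∈ C} (1 - φ(a ↔ c)) ≤ φ(∀ a ∈ A, c ∈ C : a ↮ c)`, `q ≥ 1`.
[cite: Aizenman2025, §9.3 (proof of Thm 9.1, FKG step)] -/
theorem prod_prod_le_rcMeasure_disconnected {p q : ℝ} (hp : p ∈ Set.Icc (0 : ℝ) 1) (hq : 1 ≤ q)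
    (B : Set V) (A C : Finset V) :
    ∏ a ∈ A, ∏ c ∈ C, (1 - (rcMeasure G p q B).real (Percolation.openConn a c)) ≤
      (rcMeasure G p q B).real
        {ω | ∀ a ∈ A, ∀ c ∈ C, ¬ (Percolation.openGraph ω).Reachable a c} := by
  classical
  have hq0 : (0 : ℝ) < q := one_pos.trans_le hq
  have hset : {ω : Percolation.BondConfig V | ∀ a ∈ A, ∀ c ∈ C,
      ¬ (Percolation.openGraph ω).Reachable a c} =
        ⋂ x ∈ A ×ˢ C, (Percolation.openConn x.1 x.2)ᶜ := by
    ext ω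
    simp only [Set.mem_setOf_eq, Set.mem_iInter, Set.mem_compl_iff, Percolation.openConn,
      Finset.mem_product, and_imp, Prod.forall]
    constructor
    · intro h a c ha hc; exact h a ha c hc
    · intro h a ha c hc; exact h a c ha hc
  rw [hset, ← Finset.prod_product' (f := fun a c =>
    1 - (rcMeasure G p q B).real (Percolation.openConn a c))]
  have h1 : ∀ x ∈ A ×ˢ C, 1 - (rcMeasure G p q B).real (Percolation.openConn x.1 x.2) =
      (rcMeasure G p q B).real (Percolation.openConn x.1 x.2)ᶜ := fun x _ => by
    rw [rcMeasure_real_compl G hp hq0 B]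
  rw [Finset.prod_congr rfl h1]
  exact prod_rcMeasure_real_le_biInter G hp hq B (A ×ˢ C) _
    fun x _ => (Percolation.isUpperSet_openConn x.1 x.2).compl

end FKG

/-! ### §5 Aizenman's deconfinement lower bound for the disorder operator -/

section Deconfinement

variable [Fintype V] [DecidableEq V] (G : SimpleGraph V) [DecidableRel G.Adj]

/-- **Lemma 9.3 of Aizenman 2025** (convexity of the exponential, in the form used in the proof of Thm 9.1):
for `0 < R < 1` and `0 ≤ r ≤ R`, `1 - r ≥ e^{-g(R) r}` with `g(R) = -log(1-R)/R`, i.e.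
`exp((log(1-R)/R) r) ≤ 1 - r`. Proof: concavity of `log` between `1` and `1 - R`. [cite: Aizenman2025, Lemma 9.3] -/
theorem exp_mul_le_one_sub {R r : ℝ} (hR0 : 0 < R) (hR1 : R < 1) (hr0 : 0 ≤ r) (hrR : r ≤ R) :
    Real.exp (Real.log (1 - R) / R * r) ≤ 1 - r := by
  have h1R : 0 < 1 - R := by linarith
  have h1r : 0 < 1 - r := by linarith
  have ha : 0 ≤ 1 - r / R := by
    rw [sub_nonneg, div_le_one hR0]; exact hrR
  have hb : 0 ≤ r / R := div_nonneg hr0 hR0.le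
  have hab : 1 - r / R + r / R = 1 := by ring
  have key := (strictConcaveOn_log_Ioi.concaveOn).2 (x := (1 : ℝ)) (y := 1 - R)
    (Set.mem_Ioi.2 one_pos) (Set.mem_Ioi.2 h1R) ha hb hab
  simp only [smul_eq_mul, Real.log_one, mul_zero, zero_add, mul_one] at key
  have hpt : 1 - r / R + r / R * (1 - R) = 1 - r := by
    field_simp
    ring
  rw [hpt] at key
  calc Real.exp (Real.log (1 - R) / R * r) = Real.exp (r / R * Real.log (1 - R)) := by
        congr 1; field_simp
    _ ≤ Real.exp (Real.log (1 - r)) := Real.exp_le_exp.2 key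
    _ = 1 - r := Real.exp_log h1r

/-- **The perimeter-type lower bound, product form** (Aizenman 2025, §9.3, proof of Thm 9.1, with the
Edwards–Sokal identity `1 - φ(a ↔ c) = 1 - ⟨σ_a σ_c⟩`): for `β ≥ 0`, `S ⊆ E(G)` transversal to `(Γ, h)` and
finite sets `A ⊇ wall₁`, `C ⊇ wall₂`,
`∏_{a ∈ A} ∏_{c ∈ C} (1 - ⟨σ_a σ_c⟩_{G,β}) ≤ ⟨μ_S⟩_{G,β} = ⟨T_S⟩_{G,β}`.
[cite: Aizenman2025, §9.3 (proof of Thm 9.1, product bound)] -/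
theorem prod_one_sub_twoPoint_le_isingExpect_disorderWeight {β : ℝ} (hβ : 0 ≤ β)
    {S : Finset (Sym2 V)} (hS : S ⊆ G.edgeFinset) {Γ : Set V} {h : V → Bool}
    (hT : IsTransversal G S Γ h) {A C : Finset V} (hA : wall G Γ h true ⊆ ↑A)
    (hC : wall G Γ h false ⊆ ↑C) :
    ∏ a ∈ A, ∏ c ∈ C, (1 - isingTwoPoint G univ β 0 .free a c) ≤
      isingExpect G univ β 0 .free (disorderWeight β S) := by
  classical
  have hp : fkIsingParam β ∈ Set.Icc (0 : ℝ) 1 := fkIsingParam_mem_Icc hβ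
  have hq : (1 : ℝ) ≤ 2 := one_le_two
  rw [isingExpect_disorderWeight_eq_rcMeasure_unfrustrated G hβ hS]
  have hES : ∀ a c : V, isingTwoPoint G univ β 0 .free a c =
      (rcMeasure G (fkIsingParam β) 2 ∅).real (Percolation.openConn a c) := fun a c =>
    edwardsSokal_twoPoint_holds G hβ a c
  simp_rw [hES]
  refine (prod_prod_le_rcMeasure_disconnected G hp hq ∅ A C).trans ?_
  refine rcMeasure_real_mono_on_edgeFinset G hp two_pos ∅ fun ω hω hdis => ?_
  refine wallsDisconnected_subset_unfrustrated hT ?_ ?_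
  · intro e he
    exact SimpleGraph.mem_edgeFinset.1 (hω (Finset.mem_coe.1 he))
  · intro x hx z hz
    exact hdis x (hA hx) z (hC hz)

/-- The free two-point function of a finite graph is nonnegative (Griffiths I, here from
Edwards–Sokal: it is a probability). [cite: Grimmett2006, Thm 1.16] -/
private theorem isingTwoPoint_nonneg {β : ℝ} (hβ : 0 ≤ β) (a c : V) :
    0 ≤ isingTwoPoint G univ β 0 .free a c := by
  rw [edwardsSokal_twoPoint_holds G hβ a c]
  exact measureReal_nonneg

/-- In finite volume distinct spins are never perfectly correlated: `⟨σ_a σ_c⟩_{G,β} < 1` for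
`a ≠ c` (the all-closed bond configuration has positive FK weight and disconnects `a` from `c`).
Supplies the constant `R(β*) < 1` of Aizenman 2025, §9.3, in finite volume. [cite: Aizenman2025, §9.3 (proof of Thm 9.1, R(β*) < 1)] -/
theorem isingTwoPoint_lt_one {β : ℝ} (hβ : 0 ≤ β) {a c : V} (hac : a ≠ c) :
    isingTwoPoint G univ β 0 .free a c < 1 := by
  classical
  have hp : fkIsingParam β ∈ Set.Icc (0 : ℝ) 1 := fkIsingParam_mem_Icc hβ
  have hq : (0 : ℝ) < 2 := two_pos
  have hZ := rcPartitionFunction_pos G hp hq ∅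
  rw [edwardsSokal_twoPoint_holds G hβ a c, show (1 - Real.exp (-2 * β)) = fkIsingParam β from rfl]
  -- the complement has mass at least `w(∅)/Z > 0`
  have hcompl : 0 < (rcMeasure G (fkIsingParam β) 2 ∅).real (Percolation.openConn a c)ᶜ := by
    rw [rcMeasure_real_apply G hp hq ∅ (Percolation.openConn a c)ᶜ]
    have hmem : (∅ : Finset (Sym2 V)) ∈ G.edgeFinset.powerset := Finset.empty_mem_powerset _
    refine lt_of_lt_of_le ?_ (Finset.single_le_sum (fun ω _ => ?_) hmem)
    · have hnot : ((↑(∅ : Finset (Sym2 V)) : Percolation.BondConfig V)) ∈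
          (Percolation.openConn a c)ᶜ := by
        simp only [Finset.coe_empty, Set.mem_compl_iff, Percolation.openConn, Set.mem_setOf_eq,
          Percolation.openGraph, SimpleGraph.fromEdgeSet_empty, SimpleGraph.reachable_bot]
        exact hac
      rw [if_pos hnot]
      refine div_pos ?_ hZ
      have h1 : 0 < 1 - fkIsingParam β := by
        simp only [fkIsingParam, sub_sub_cancel]; exact Real.exp_pos _
      rw [rcWeight, Finset.card_empty, pow_zero, one_mul]
      exact mul_pos (pow_pos h1 _) (pow_pos two_pos _)
    · split_ifs
      · exact div_nonneg (rcWeight_nonneg G hp hq.le ∅ ω) hZ.le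
      · exact le_rfl
  rw [rcMeasure_real_compl G hp hq ∅] at hcompl
  linarith

/-- **Aizenman's deconfinement bound, exponential form** (Aizenman 2025, §9.3, last two displays of the
proof of Thm 9.1, with Lemma 9.3): if `R ∈ (0, 1)` dominates the two-point functions `⟨σ_a σ_c⟩_{G,β}`, `a ∈ A`, `c ∈ C`,
then `⟨T_S⟩_{G,β} = ⟨μ_S⟩_{G,β} ≥ exp( (log(1-R)/R) ∑_{a ∈ A} ∑_{c ∈ C} ⟨σ_a σ_c⟩_{G,β} )`
(`log(1-R)/R = -λ(β)` in the notation of the source). In `d = 3`, with `⟨σσ⟩` decaying exponentially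
(`β* < β_c^{Ising}`), the double sum over the two walls of the cylinder is `O(per(γ))`: the
perimeter law of Thm 9.1 (not typed; infinite volume). [cite: Aizenman2025, §9.3 (proof of Thm 9.1, final display) and Lemma 9.3] -/
theorem exp_mul_sum_twoPoint_le_isingExpect_disorderWeight {β : ℝ} (hβ : 0 ≤ β)
    {S : Finset (Sym2 V)} (hS : S ⊆ G.edgeFinset) {Γ : Set V} {h : V → Bool}
    (hT : IsTransversal G S Γ h) {A C : Finset V} (hA : wall G Γ h true ⊆ ↑A)
    (hC : wall G Γ h false ⊆ ↑C) {R : ℝ} (hR0 : 0 < R) (hR1 : R < 1)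
    (hle : ∀ a ∈ A, ∀ c ∈ C, isingTwoPoint G univ β 0 .free a c ≤ R) :
    Real.exp (Real.log (1 - R) / R * ∑ a ∈ A, ∑ c ∈ C, isingTwoPoint G univ β 0 .free a c) ≤
      isingExpect G univ β 0 .free (disorderWeight β S) := by
  refine le_trans ?_ (prod_one_sub_twoPoint_le_isingExpect_disorderWeight G hβ hS hT hA hC)
  rw [Finset.mul_sum, Real.exp_sum]
  refine Finset.prod_le_prod (fun a _ => (Real.exp_pos _).le) fun a ha => ?_
  rw [Finset.mul_sum, Real.exp_sum]
  refine Finset.prod_le_prod (fun c _ => (Real.exp_pos _).le) fun c hc => ?_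
  exact exp_mul_le_one_sub hR0 hR1 (isingTwoPoint_nonneg G hβ a c) (hle a ha c hc)

end Deconfinement

/-! ### §6 The three-dimensional instance (Aizenman 2025, §9.3): a horizontal square pierced by
vertical bonds

The geometry of the source, on an arbitrary finite region `Λ ⊆ ℤ³` carrying the nearest-neighbour
graph (in the application `Λ` is the set of dual sites `Λ*` of a box, itself a box of the dual
cubic lattice `(ℤ³)* ≅ ℤ³`): `S` = the vertical bonds `{x, x + e₃}` with `x₃ = 0` and footprint
`(x₁, x₂) ∈ F` (the bonds dual to the plaquettes of the square `S_ℓ` when `F` is an `ℓ × ℓ` square);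
`Γ` = the cylinder `{(x₁, x₂) ∈ F}`; the colour `h` = "above the square" (`x₃ ≥ 1`). Transversality
holds for every footprint `F`, so §5 gives Aizenman's displayed bound with the two lateral walls
of the cylinder. -/

section ThreeDim

/-- The nearest-neighbour graph induced on a finite region `Λ ⊆ ℤ³` (the finite "rectangular
subgraphs `Λ ⊂ ℤ³`" and their duals of Aizenman 2025, §9.2). [cite: Aizenman2025, §9.2 (Thm 9.2, rectangular subgraphs)] -/
noncomputable abbrev regionGraph (Λ : Finset (Site 3)) : SimpleGraph ↥Λ :=
  (zdGraph 3).comap (Subtype.val : ↥Λ → Site 3)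

variable (Λ : Finset (Site 3)) (F : Set (ℤ × ℤ))

/-- The footprint `(x₁, x₂)` of a site of `ℤ³`. [cite: Aizenman2025, §9.3 (the cylinder Γ_ℓ = Λ* ∩ [S_ℓ × ℝ])] -/
def footprint (x : Site 3) : ℤ × ℤ := (x 0, x 1)

/-- The **cylinder** over the footprint `F`: `Γ = Λ ∩ (F × ℤ)` (Aizenman 2025, §9.3:
`Γ_ℓ = Λ* ∩ [S_ℓ × (ℝ + 1/2)]`). [cite: Aizenman2025, §9.3 (definition of Γ_ℓ)] -/
def cylinder : Set ↥Λ := {v | footprint v.1 ∈ F}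

/-- The colour "above the square": `x₃ ≥ 1` (the plane of the square separates `x₃ ≤ 0` from
`x₃ ≥ 1`). [cite: Aizenman2025, §9.3 (the two parts into which S_ℓ cuts ∂Γ_ℓ)] -/
def above (v : ↥Λ) : Bool := decide (1 ≤ v.1 2)

/-- `x` is the foot and `y = x + e₃` the head of a vertical bond piercing the square over `F` at
height between `x₃ = 0` and `x₃ = 1`. [cite: Aizenman2025, §9.3 (the edges which pierce S)] -/
def IsPiercingPair (x y : Site 3) : Prop :=
  footprint x ∈ F ∧ x 2 = 0 ∧ y = x + Pi.single 2 1

/-- The unordered version of `IsPiercingPair`. [cite: Aizenman2025, §9.3 (the edges which pierce S)] -/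
def IsPiercing : Sym2 ↥Λ → Prop :=
  Sym2.lift ⟨fun u v => IsPiercingPair F u.1 v.1 ∨ IsPiercingPair F v.1 u.1, fun _ _ => propext or_comm⟩

omit Λ in
/-- `IsPiercing` on a concrete pair. [cite: Aizenman2025, §9.3 (the edges which pierce S)] -/
@[simp] theorem isPiercing_mk {Λ : Finset (Site 3)} (u v : ↥Λ) :
    IsPiercing Λ F s(u, v) ↔ IsPiercingPair F u.1 v.1 ∨ IsPiercingPair F v.1 u.1 := Iff.rfl

open scoped Classical in
/-- **The pierced bonds `S`**: the bonds of the region graph dual to the plaquettes of the square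
(Aizenman 2025, §9.3: the bonds of `Λ*` which cross `S`). [cite: Aizenman2025, §9.3 (the dual edges which cross S)] -/
noncomputable def piercingBonds : Finset (Sym2 ↥Λ) :=
  (regionGraph Λ).edgeFinset.filter (IsPiercing Λ F)

/-- `S ⊆ E`. [cite: Aizenman2025, §9.3] -/
theorem piercingBonds_subset : piercingBonds Λ F ⊆ (regionGraph Λ).edgeFinset := by
  classical
  unfold piercingBonds; exact Finset.filter_subset _ _

/-- Membership in `S`. [cite: Aizenman2025, §9.3] -/
theorem mem_piercingBonds {e : Sym2 ↥Λ} :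
    e ∈ piercingBonds Λ F ↔ e ∈ (regionGraph Λ).edgeFinset ∧ IsPiercing Λ F e := by
  classical
  unfold piercingBonds
  rw [Finset.mem_filter]

omit Λ in
/-- Coordinates of `x + eᵢ`. [folklore] -/
private theorem add_single_apply (x : Site 3) (i j : Fin 3) :
    (x + Pi.single i 1 : Site 3) j = x j + if j = i then 1 else 0 := by
  simp only [Pi.add_apply, Pi.single_apply]

/-- **The square is transversal to the cylinder** (Aizenman 2025, §9.3, "by the geometry of this
setup": inside the cylinder the only bonds joining the two sides of the plane of the square are the
bonds piercing the square): `IsTransversal` holds for `S = piercingBonds`, `Γ = cylinder`,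
`h = above`, for every region `Λ` and footprint `F`. [cite: Aizenman2025, §9.3 (geometric step)] -/
theorem isTransversal_piercingBonds :
    IsTransversal (regionGraph Λ) (piercingBonds Λ F) (cylinder Λ F) (above Λ) := by
  classical
  -- a piercing pair lies in the cylinder and joins the two colours
  have key : ∀ x y : ↥Λ, IsPiercingPair F x.1 y.1 →
      x ∈ cylinder Λ F ∧ y ∈ cylinder Λ F ∧ above Λ x ≠ above Λ y := by
    rintro x y ⟨hF, hx2, hy⟩
    have hy0 : y.1 0 = x.1 0 := by rw [hy, add_single_apply]; simp
    have hy1 : y.1 1 = x.1 1 := by rw [hy, add_single_apply]; simp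
    have hy2 : y.1 2 = 1 := by rw [hy, add_single_apply]; simp [hx2]
    refine ⟨hF, ?_, ?_⟩
    · show footprint y.1 ∈ F
      rw [footprint, hy0, hy1]; exact hF
    · simp [above, hx2, hy2]
  refine ⟨?_, ?_⟩
  · intro x y hS
    rcases ((mem_piercingBonds Λ F).1 hS).2 with h | h
    · exact key x y h
    · obtain ⟨hy, hx, hne⟩ := key y x h
      exact ⟨hx, hy, hne.symm⟩
  · intro x y hadj hx hy hne
    rw [mem_piercingBonds]
    refine ⟨SimpleGraph.mem_edgeFinset.2 ((SimpleGraph.mem_edgeSet _).2 hadj), ?_⟩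
    have hadj' : (zdGraph 3).Adj x.1 y.1 := hadj
    obtain ⟨i, hi⟩ := (zdGraph_adj_iff _ _).1 hadj'
    -- the bond is vertical (`i = 2`) and straddles the plane
    have hcoord : ∀ j, j ≠ i → x.1 j = y.1 j := by
      intro j hj
      rcases hi with h | h
      · rw [h, add_single_apply, if_neg hj, add_zero]
      · rw [h, add_single_apply, if_neg hj, add_zero]
    have hi2 : i = 2 := by
      by_contra hi2
      have h2 : x.1 2 = y.1 2 := hcoord 2 (Ne.symm hi2)
      apply hne
      simp [above, h2]
    subst hi2
    simp only [isPiercing_mk]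
    rcases hi with h | h
    · -- `y = x + e₃`: then `x₃ = 0`
      left
      have h2 : y.1 2 = x.1 2 + 1 := by rw [h, add_single_apply]; simp
      have hx2 : x.1 2 = 0 := by
        by_contra hx2
        apply hne
        have : (1 ≤ x.1 2) ↔ (1 ≤ y.1 2) := by rw [h2]; omega
        simp [above, this]
      exact ⟨hx, hx2, h⟩
    · -- `x = y + e₃`: then `y₃ = 0`
      right
      have h2 : x.1 2 = y.1 2 + 1 := by rw [h, add_single_apply]; simp
      have hy2 : y.1 2 = 0 := by
        by_contra hy2
        apply hne
        have : (1 ≤ x.1 2) ↔ (1 ≤ y.1 2) := by rw [h2]; omega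
        simp [above, this]
      exact ⟨hy, hy2, h⟩

/-- **Aizenman's product bound in its three-dimensional form** (Aizenman 2025, §9.3, proof of
Thm 9.1, the display `⟨T_{S_γ}⟩_{Λ*,β*} ≥ ∏_{u ∈ (∂Γ_ℓ)₁} ∏_{v ∈ (∂Γ_ℓ)₂} [1 - ⟨σ_u σ_v⟩_{Λ*,β*}]`,
with the finite-volume two-point function in place of its infinite-volume majorant): for the
free-boundary Ising model at `β ≥ 0` on any finite region `Λ ⊆ ℤ³`, any footprint `F`, and finite
sets `A ⊇ wall₁` (sites of the cylinder above the square with a neighbour in `Λ` outside the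
cylinder), `C ⊇ wall₂` (the same below),
`∏_{a ∈ A} ∏_{c ∈ C} (1 - ⟨σ_a σ_c⟩_{Λ,β}) ≤ ⟨μ_S⟩_{Λ,β} = ⟨T_S⟩_{Λ,β}`. [cite: Aizenman2025, §9.3 (proof of Thm 9.1, product bound)] -/
theorem prod_one_sub_twoPoint_le_disorder_square {β : ℝ} (hβ : 0 ≤ β) {A C : Finset ↥Λ}
    (hA : wall (regionGraph Λ) (cylinder Λ F) (above Λ) true ⊆ ↑A)
    (hC : wall (regionGraph Λ) (cylinder Λ F) (above Λ) false ⊆ ↑C) :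
    ∏ a ∈ A, ∏ c ∈ C, (1 - isingTwoPoint (regionGraph Λ) univ β 0 .free a c) ≤
      isingExpect (regionGraph Λ) univ β 0 .free (disorderWeight β (piercingBonds Λ F)) :=
  prod_one_sub_twoPoint_le_isingExpect_disorderWeight (regionGraph Λ) hβ (piercingBonds_subset Λ F)
    (isTransversal_piercingBonds Λ F) hA hC

/-- The exponential form in three dimensions (Aizenman 2025, §9.3, final display of the proof of
Thm 9.1: `⟨T_{S_γ}⟩ ≥ exp[-λ(β) ∑_{u ∈ (∂Γ)₁} ∑_{v ∈ (∂Γ)₂} ⟨σ_u σ_v⟩]`). [cite: Aizenman2025, §9.3 (proof of Thm 9.1, final display) and Lemma 9.3] -/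
theorem exp_mul_sum_twoPoint_le_disorder_square {β : ℝ} (hβ : 0 ≤ β) {A C : Finset ↥Λ}
    (hA : wall (regionGraph Λ) (cylinder Λ F) (above Λ) true ⊆ ↑A)
    (hC : wall (regionGraph Λ) (cylinder Λ F) (above Λ) false ⊆ ↑C) {R : ℝ} (hR0 : 0 < R)
    (hR1 : R < 1) (hle : ∀ a ∈ A, ∀ c ∈ C, isingTwoPoint (regionGraph Λ) univ β 0 .free a c ≤ R) :
    Real.exp (Real.log (1 - R) / R *
        ∑ a ∈ A, ∑ c ∈ C, isingTwoPoint (regionGraph Λ) univ β 0 .free a c) ≤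
      isingExpect (regionGraph Λ) univ β 0 .free (disorderWeight β (piercingBonds Λ F)) :=
  exp_mul_sum_twoPoint_le_isingExpect_disorderWeight (regionGraph Λ) hβ (piercingBonds_subset Λ F)
    (isTransversal_piercingBonds Λ F) hA hC hR0 hR1 hle

end ThreeDim

end DisorderFK

end Literature.Probability.LatticeModels
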